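import Summits.CriticalPhenomena.PercolationContinuityZ3.Theorems.PercNearOneGluingNoHeavyPcintSignedConfigCount
import HarnessLib

/-!
# CriticalPhenomena/PercolationContinuityZ3 — Theorems/PercNearOneGluingNoHeavyPcintSignedConfigCore.lean: the CORE of an arch configuration, ranks, and the next gap

Lane prim-pcint, STRUCTURE rule «numerics ⇒ structure ⇒ conjecture» (prim-pcint-2 GEN 22); sequel of …PcintSignedConfigCount.  Second level of the
forest decomposition: an indecomposable configuration `c` has a CORE `core c` — the points lying in no proper closed interval — which is closed,
letter-free, contains the least and the greatest point, and is IRREDUCIBLE in the sense that a non-empty closed subset of the core that is convex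
relative to the core is the whole core (`core_block`); the other points fall into the GAPS between consecutive core points.  To peel the gaps one at a
time we use RANKS (`rank x = #{y < x}`), the predicate `EPfx i c` ("the `i+1` smallest points are core points", i.e. the first `i` gaps are empty)
and the NEXT GAP `ngap c i` (the run of non-core points following the point of rank `i`), which is a closed convex set avoiding the core
(`closed_ngap`, `mem_ngap_iff_lt`).  All of this is transported along order isomorphisms (`mem_core_conj`, `rank_conj`), giving the refined
counting functions `epCount i S N`.  The sequel …PcintSignedConfigPeel proves the gap recursion.

HONEST FRAMING: elementary finite combinatorics.  No `sorry`; standard axioms.  Written by prim-pcint-2 gen 22 (prover-prim-pcint-2-g22-0), 2026-08-27.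
-/

namespace Summit.CriticalPhenomena.PercolationContinuityZ3.Theorems.Pcint.ChordDiag

variable {α β : Type*} [LinearOrder α] [Fintype α] [LinearOrder β] [Fintype β]

/-! ### The core -/

open Classical in
/-- The CORE: the points lying in no proper closed interval. [folklore] -/
noncomputable def core (c : Cfg α) : Finset α :=
  Finset.univ.filter fun x => ∀ J : Finset α, x ∈ J → Convex J → Closed c.1 J → J = Finset.univ

/-- Membership in the core. [folklore] -/
theorem mem_core {c : Cfg α} {x : α} : x ∈ core c ↔ ∀ J : Finset α, x ∈ J → Convex J → Closed c.1 J → J = Finset.univ := by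
  simp [core]

/-- A point outside the core lies in a proper closed interval. [folklore] -/
theorem exists_of_not_mem_core {c : Cfg α} {x : α} (h : x ∉ core c) :
    ∃ J : Finset α, x ∈ J ∧ Convex J ∧ Closed c.1 J ∧ J ≠ Finset.univ := by
  rw [mem_core] at h
  push Not at h
  exact h

/-- A proper closed interval misses the core. [folklore] -/
theorem not_mem_core_of_mem {c : Cfg α} {J : Finset α} (hcv : Convex J) (hcl : Closed c.1 J) (hne : J ≠ Finset.univ) {x : α}
    (hx : x ∈ J) : x ∉ core c := fun h => hne (mem_core.1 h J hx hcv hcl)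

section Core

variable {c : Cfg α}

/-- The core is closed. [folklore] -/
theorem closed_core (hc : IsCfg c) : Closed c.1 (core c) := by
  intro x hx
  by_contra h
  obtain ⟨J, hJ, hcv, hcl, hne⟩ := exists_of_not_mem_core h
  have : x ∈ J := by have := hcl hJ; rwa [hc.1] at this
  exact hne (mem_core.1 hx J this hcv hcl)

/-- The least point is a core point (indecomposable configuration). [folklore] -/
theorem min_mem_core (hi : Indec c) (hu : (Finset.univ : Finset α).Nonempty) : Finset.univ.min' hu ∈ core c := by
  refine mem_core.2 fun J hJ hcv hcl => hi.2 J ⟨_, hJ⟩ (fun x hx y hyx => ?_) hcl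
  exact hcv hJ hx (Finset.min'_le _ _ (Finset.mem_univ y)) hyx

/-- The greatest point is a core point (indecomposable configuration). [folklore] -/
theorem max_mem_core (hc : IsCfg c) (hi : Indec c) (hu : (Finset.univ : Finset α).Nonempty) : Finset.univ.max' hu ∈ core c := by
  refine mem_core.2 fun J hJ hcv hcl => ?_
  by_contra hne
  -- the complement is a non-empty closed initial segment
  have hcne : (Jᶜ).Nonempty := by
    rw [Finset.nonempty_iff_ne_empty, Ne, Finset.compl_eq_empty_iff]; exact hne
  have hci : Init Jᶜ := fun x hx y hyx => by
    rw [Finset.mem_compl] at hx ⊢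
    exact fun hy => hx (hcv hy hJ hyx (Finset.le_max' _ _ (Finset.mem_univ x)))
  have := hi.2 _ hcne hci (hc.closed_compl hcl)
  rw [Finset.compl_eq_univ_iff] at this
  rw [this] at hJ
  exact Finset.notMem_empty _ hJ

/-- Core points are not letters. [folklore] -/
theorem not_letter_of_mem_core (hi : Indec c) {x : α} (hx : x ∈ core c) : c.1 x ≠ x := by
  intro hxx
  have hcv : Convex ({x} : Finset α) := fun a ha b hb t hat htb => by
    rw [Finset.mem_singleton] at ha hb ⊢; subst ha; subst hb; exact le_antisymm htb hat
  have hcl : Closed c.1 {x} := fun t ht => by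
    rw [Finset.mem_singleton] at ht ⊢; subst ht; exact hxx
  have hu := mem_core.1 hx {x} (Finset.mem_singleton_self x) hcv hcl
  obtain ⟨t, ht⟩ := hi.1
  have : t ∈ ({x} : Finset α) := hu ▸ Finset.mem_univ t
  rw [Finset.mem_singleton] at this
  subst this
  exact ht hxx

/-- A proper closed interval lies on one side of any core point. [folklore] -/
theorem lt_or_gt_of_mem_core {J : Finset α} (hcv : Convex J) (hcl : Closed c.1 J) (hne : J ≠ Finset.univ) {k : α} (hk : k ∈ core c)
    {s t : α} (hs : s ∈ J) (ht : t ∈ J) : ¬(s ≤ k ∧ k ≤ t) := fun h =>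
  not_mem_core_of_mem hcv hcl hne (hcv hs ht h.1 h.2) hk

/-- **The core is irreducible**: a non-empty closed subset of the core, convex relative to the core, is the whole core. [folklore] -/
theorem core_block {B : Finset α} (hB : B ⊆ core c) (hne : B.Nonempty)
    (hcv : ∀ ⦃x⦄, x ∈ B → ∀ ⦃y⦄, y ∈ B → ∀ ⦃t⦄, t ∈ core c → x ≤ t → t ≤ y → t ∈ B) (hcl : Closed c.1 B) : B = core c := by
  classical
  set m := B.min' hne
  set M := B.max' hne
  set J : Finset α := Finset.univ.filter fun t => m ≤ t ∧ t ≤ M with hJ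
  have memJ : ∀ {t}, t ∈ J ↔ m ≤ t ∧ t ≤ M := fun {t} => by simp [hJ]
  have hJcv : Convex J := fun x hx y hy t hxt hty => memJ.2 ⟨(memJ.1 hx).1.trans hxt, hty.trans (memJ.1 hy).2⟩
  have hmB : m ∈ B := Finset.min'_mem _ _
  have hMB : M ∈ B := Finset.max'_mem _ _
  have hJcl : Closed c.1 J := by
    intro t ht
    obtain ⟨hmt, htM⟩ := memJ.1 ht
    by_cases htc : t ∈ core c
    · have htB : t ∈ B := hcv hmB hMB htc hmt htM
      have := hcl htB
      exact memJ.2 ⟨Finset.min'_le _ _ this, Finset.le_max' _ _ this⟩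
    · obtain ⟨J₀, ht₀, hcv₀, hcl₀, hne₀⟩ := exists_of_not_mem_core htc
      have h1 := hcl₀ ht₀
      refine memJ.2 ⟨?_, ?_⟩
      · by_contra h
        exact lt_or_gt_of_mem_core hcv₀ hcl₀ hne₀ (hB hmB) h1 ht₀ ⟨(not_le.1 h).le, hmt⟩
      · by_contra h
        exact lt_or_gt_of_mem_core hcv₀ hcl₀ hne₀ (hB hMB) ht₀ h1 ⟨htM, (not_le.1 h).le⟩
  have hJu : J = Finset.univ := mem_core.1 (hB hmB) J (memJ.2 ⟨le_rfl, Finset.min'_le _ _ hMB⟩) hJcv hJcl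
  refine Finset.Subset.antisymm hB fun t ht => ?_
  have := memJ.1 (hJu ▸ Finset.mem_univ t)
  exact hcv hmB hMB ht this.1 this.2

end Core

/-! ### Ranks, the empty-prefix predicate, the next gap -/

/-- The rank of a point: the number of smaller points. [folklore] -/
def rank (x : α) : ℕ := (Finset.univ.filter (· < x)).card

/-- Ranks are monotone. [folklore] -/
theorem rank_le_rank {x y : α} (h : x ≤ y) : rank x ≤ rank y :=
  Finset.card_le_card fun t ht => by
    rw [Finset.mem_filter] at ht ⊢; exact ⟨ht.1, lt_of_lt_of_le ht.2 h⟩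

/-- Ranks are strictly monotone. [folklore] -/
theorem rank_lt_rank {x y : α} (h : x < y) : rank x < rank y :=
  Finset.card_lt_card ⟨fun t ht => by rw [Finset.mem_filter] at ht ⊢; exact ⟨ht.1, ht.2.trans h⟩,
    fun hs => by have := hs (Finset.mem_filter.2 ⟨Finset.mem_univ x, h⟩); simp at this⟩

/-- Equal ranks, equal points. [folklore] -/
theorem rank_injective : Function.Injective (rank : α → ℕ) := fun x y h => by
  rcases lt_trichotomy x y with hxy | hxy | hxy
  · exact absurd h (rank_lt_rank hxy).ne
  · exact hxy
  · exact absurd h (rank_lt_rank hxy).ne'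

/-- The order is the order of the ranks. [folklore] -/
theorem le_iff_rank_le {x y : α} : x ≤ y ↔ rank x ≤ rank y :=
  ⟨rank_le_rank, fun h => not_lt.1 fun h' => absurd h (not_le.2 (rank_lt_rank h'))⟩

/-- Ranks are bounded by the size. [folklore] -/
theorem rank_lt_card (x : α) : rank x < Fintype.card α := by
  unfold rank
  rw [← Finset.card_univ]
  exact Finset.card_lt_card ⟨Finset.filter_subset _ _, fun h => by have := h (Finset.mem_univ x); simp at this⟩

/-- In `Fin N` the rank is the value. [folklore] -/
theorem rank_fin {N : ℕ} (x : Fin N) : rank x = (x : ℕ) := by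
  unfold rank
  have : Finset.univ.filter (· < x) = Finset.Iio x := by ext t; simp
  rw [this, Fin.card_Iio]

/-- Ranks are transported. [folklore] -/
theorem rank_conj (e : α ≃o β) (x : α) : rank (e x) = rank x := by
  unfold rank
  rw [← Finset.card_map e.toEquiv.toEmbedding]
  congr 1
  ext t
  rw [Finset.mem_map_equiv]
  simp only [Finset.mem_filter, Finset.mem_univ, true_and]
  constructor
  · intro h; simpa using e.symm.strictMono h
  · intro h; simpa using e.strictMono h

/-- **Every rank below the size occurs.** [folklore] -/
theorem exists_rank_eq {i : ℕ} (hi : i < Fintype.card α) : ∃ x : α, rank x = i := by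
  set e := Fintype.orderIsoFinOfCardEq α rfl
  exact ⟨e ⟨i, hi⟩, by rw [rank_conj, rank_fin]⟩

omit [Fintype α] in
/-- The rank of a point of a part, computed in the ambient order. [folklore] -/
theorem rank_coe (S : Finset α) (x : ↥S) : rank x = (S.filter (· < (x : α))).card := by
  unfold rank
  rw [← Finset.card_map (Function.Embedding.subtype _)]
  congr 1
  ext t
  constructor
  · intro h
    obtain ⟨u, hu, rfl⟩ := Finset.mem_map.1 h
    rw [Finset.mem_filter] at hu ⊢
    exact ⟨u.2, hu.2⟩
  · intro h
    rw [Finset.mem_filter] at h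
    exact Finset.mem_map.2 ⟨⟨t, h.1⟩, Finset.mem_filter.2 ⟨Finset.mem_univ _, h.2⟩, rfl⟩

/-- `EPfx i c`: the points of rank `≤ i` are core points (the first `i` gaps are empty). [folklore] -/
def EPfx (i : ℕ) (c : Cfg α) : Prop := ∀ x : α, rank x ≤ i → x ∈ core c

open Classical in
/-- The NEXT GAP after the point of rank `i`: the points of rank `> i` with no core point of rank `> i` below or at them. [folklore] -/
noncomputable def ngap (c : Cfg α) (i : ℕ) : Finset α :=
  Finset.univ.filter fun x => i < rank x ∧ ∀ y, y ≤ x → i < rank y → y ∉ core c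

/-- Membership in the next gap. [folklore] -/
theorem mem_ngap {c : Cfg α} {i : ℕ} {x : α} : x ∈ ngap c i ↔ i < rank x ∧ ∀ y, y ≤ x → i < rank y → y ∉ core c := by
  simp [ngap]

section Gap

variable {c : Cfg α} {i : ℕ}

/-- The next gap misses the core. [folklore] -/
theorem not_mem_core_of_mem_ngap {x : α} (hx : x ∈ ngap c i) : x ∉ core c := (mem_ngap.1 hx).2 x le_rfl (mem_ngap.1 hx).1

/-- The next gap is closed downwards above rank `i`. [folklore] -/
theorem mem_ngap_of_le {x y : α} (hx : x ∈ ngap c i) (hyx : y ≤ x) (hy : i < rank y) : y ∈ ngap c i :=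
  mem_ngap.2 ⟨hy, fun z hzy hz => (mem_ngap.1 hx).2 z (hzy.trans hyx) hz⟩

/-- The next gap is convex. [folklore] -/
theorem convex_ngap (c : Cfg α) (i : ℕ) : Convex (ngap c i) := fun _ hx _ hy _ hxt hty =>
  mem_ngap_of_le hy hty (lt_of_lt_of_le (mem_ngap.1 hx).1 (rank_le_rank hxt))

/-- **The next gap is closed** (the first `i` gaps being empty). [folklore] -/
theorem closed_ngap (hE : EPfx i c) : Closed c.1 (ngap c i) := by
  intro x hx
  obtain ⟨J₀, hx₀, hcv₀, hcl₀, hne₀⟩ := exists_of_not_mem_core (not_mem_core_of_mem_ngap hx)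
  have h1 : c.1 x ∈ J₀ := hcl₀ hx₀
  -- `J₀ ⊆ ngap c i`
  suffices hsub : ∀ s ∈ J₀, s ∈ ngap c i from hsub _ h1
  intro s hs
  have hsc : s ∉ core c := not_mem_core_of_mem hcv₀ hcl₀ hne₀ hs
  have hsr : i < rank s := not_le.1 fun h => hsc (hE s h)
  refine mem_ngap.2 ⟨hsr, fun y hys hyr hyc => ?_⟩
  by_cases hyJ : y ∈ J₀
  · exact not_mem_core_of_mem hcv₀ hcl₀ hne₀ hyJ hyc
  · -- `y` lies below `J₀`, hence below `x`
    have hyx : y ≤ x := by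
      by_contra h
      exact hyJ (hcv₀ hx₀ hs (not_le.1 h).le hys)
    exact (mem_ngap.1 hx).2 y hyx hyr hyc

/-- **The shape of the next gap**: with `k` the least core point of rank `> i`, `ngap c i = {x : i < rank x ∧ x < k}`. [folklore] -/
theorem mem_ngap_iff_lt {k : α} (hk : k ∈ core c) (hik : i < rank k) (hmin : ∀ y, y ∈ core c → i < rank y → k ≤ y) {x : α} :
    x ∈ ngap c i ↔ i < rank x ∧ x < k := by
  constructor
  · intro hx
    exact ⟨(mem_ngap.1 hx).1, not_le.1 fun h => (mem_ngap.1 hx).2 k h hik hk⟩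
  · rintro ⟨hxr, hxk⟩
    exact mem_ngap.2 ⟨hxr, fun y hyx hyr hyc => absurd (hmin y hyc hyr) (not_le.2 (lt_of_le_of_lt hyx hxk))⟩

/-- A least core point of rank `> i` exists as soon as there is a point of rank `i+1` (indecomposable configuration). [folklore] -/
theorem exists_next_core (hc : IsCfg c) (hI : Indec c) (hN : i + 2 ≤ Fintype.card α) :
    ∃ k, k ∈ core c ∧ i < rank k ∧ ∀ y, y ∈ core c → i < rank y → k ≤ y := by
  classical
  have hu : (Finset.univ : Finset α).Nonempty := Finset.univ_nonempty_iff.2 (Fintype.card_pos_iff.1 (by omega))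
  set C := (core c).filter fun y => i < rank y
  have hC : C.Nonempty := by
    refine ⟨Finset.univ.max' hu, Finset.mem_filter.2 ⟨max_mem_core hc hI hu, ?_⟩⟩
    obtain ⟨x, hx⟩ := exists_rank_eq (α := α) (i := i + 1) (by omega)
    have := rank_le_rank (Finset.le_max' _ x (Finset.mem_univ x))
    omega
  refine ⟨C.min' hC, (Finset.mem_filter.1 (Finset.min'_mem C hC)).1, (Finset.mem_filter.1 (Finset.min'_mem C hC)).2, fun y hy hyr => ?_⟩
  exact Finset.min'_le _ _ (Finset.mem_filter.2 ⟨hy, hyr⟩)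

end Gap

/-! ### The refined arch classes and their transport -/

open Classical in
/-- The arch configurations with sign word `S` whose first `i` gaps are empty. [folklore] -/
noncomputable def epSet (i : ℕ) (S : List Bool) (α : Type*) [LinearOrder α] [Fintype α] : Finset (Cfg α) :=
  (eSet S α).filter fun c => EPfx i c

/-- Membership in `epSet`. [folklore] -/
theorem mem_epSet {i : ℕ} {S : List Bool} {c : Cfg α} : c ∈ epSet i S α ↔ IsECfg S c ∧ EPfx i c := by
  unfold epSet
  simp only [Finset.mem_filter, mem_eSet]

/-- The refined arch counting function. [folklore] -/
noncomputable def epCount (i : ℕ) (S : List Bool) (N : ℕ) : ℕ := (epSet i S (Fin N)).card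

omit [Fintype α] [Fintype β] in
/-- Closedness is transported (pull-back, both ways). [folklore] -/
theorem closed_preO_iff (e : α ≃o β) {c : Cfg α} {I : Finset β} : Closed (Cfg.conj e c).1 I ↔ Closed c.1 (preO e I) := by
  refine ⟨Closed.preO e, fun h t ht => ?_⟩
  have := h ((mem_preO e).2 (show e (e.symm t) ∈ I by simpa using ht))
  rw [mem_preO] at this
  simpa [Cfg.conj] using this

/-- The core is transported. [folklore] -/
theorem mem_core_conj (e : α ≃o β) (c : Cfg α) (y : β) : y ∈ core (Cfg.conj e c) ↔ e.symm y ∈ core c := by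
  rw [mem_core, mem_core]
  constructor
  · intro h J hJ hcv hcl
    have := h (preO e.symm J) ((mem_preO e.symm).2 (by simpa using hJ)) (hcv.preO e.symm) ?_
    · exact (preO_eq_univ e.symm).1 this
    · rw [closed_preO_iff]
      convert hcl using 1
      ext t; rw [mem_preO, mem_preO]; simp
  · intro h J hJ hcv hcl
    have := h (preO e J) ((mem_preO e).2 (by simpa using hJ)) (hcv.preO e) (Closed.preO e hcl)
    exact (preO_eq_univ e).1 this

/-- `EPfx` is transported. [folklore] -/
theorem EPfx.conj (e : α ≃o β) {i : ℕ} {c : Cfg α} (h : EPfx i c) : EPfx i (Cfg.conj e c) := fun y hy =>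
  (mem_core_conj e c y).2 (h _ (by rw [← rank_conj e, OrderIso.apply_symm_apply]; exact hy))

/-- `#epSet` is an order-isomorphism invariant. [folklore] -/
theorem card_epSet_congr (e : α ≃o β) (i : ℕ) (S : List Bool) : (epSet i S α).card = (epSet i S β).card := by
  refine Finset.card_nbij' (Cfg.conj e) (Cfg.conj e.symm) ?_ ?_ ?_ ?_
  · intro c hc; rw [Finset.mem_coe, mem_epSet] at hc ⊢; exact ⟨hc.1.conj e, hc.2.conj e⟩
  · intro c hc; rw [Finset.mem_coe, mem_epSet] at hc ⊢; exact ⟨hc.1.conj e.symm, hc.2.conj e.symm⟩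
  · intro c _; exact conj_symm_conj e c
  · intro c _
    have := conj_symm_conj e.symm c
    simpa using this

omit [Fintype α] in
/-- A part counts as `Fin` of its size (refined arch class). [folklore] -/
theorem card_epSet_coe (A : Finset α) (i : ℕ) (S : List Bool) : (epSet i S ↥A).card = epCount i S A.card :=
  (card_epSet_congr (A.orderIsoOfFin rfl) i S).symm

/-- **`epCount 0 = eCount`**: the least point of an arch configuration is a core point. [folklore] -/
theorem epCount_zero_eq (S : List Bool) (N : ℕ) : epCount 0 S N = eCount S N := by
  classical
  unfold epCount eCount
  congr 1
  ext c
  rw [mem_epSet, mem_eSet]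
  refine ⟨fun h => h.1, fun hc => ⟨hc, fun x hx => ?_⟩⟩
  have hu : (Finset.univ : Finset (Fin N)).Nonempty := ⟨x, Finset.mem_univ x⟩
  have hx0 : x = Finset.univ.min' hu := by
    apply rank_injective
    have h1 := rank_le_rank (Finset.min'_le Finset.univ x (Finset.mem_univ x))
    omega
  rw [hx0]
  exact min_mem_core hc.2.2.1 hu

end Summit.CriticalPhenomena.PercolationContinuityZ3.Theorems.Pcint.ChordDiag
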